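import Literature.NumberTheory.ModularForms.PoincareSeriesWeightTwoHeckeUnfoldingPointwise
import Literature.NumberTheory.EllipticCurves.Gamma0UnfoldingProofs
import Literature.NumberTheory.EllipticCurves.RankinSelbergStripIntegral
import Mathlib.NumberTheory.ModularForms.Bounds
import Mathlib.MeasureTheory.Measure.Lebesgue.Complex
import Mathlib.Analysis.SpecialFunctions.Gaussian.GaussianIntegral
import HarnessLib

/-!
# Unfolding the Hecke-regularised weight-2 Poincaré series against a cusp form, II:
# `⟨yˢ P_m(·,s), f⟩ = Γ(s+1) (4πm)^{−s−1} a_f(m)` (proofs only)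

Topic `Literature/NumberTheory/ModularForms` (namespace `Literature.NumberTheory.ModularForms.PoincareWeightTwo`).
THEOREMS ONLY: stub U (`stub_heckeUnfolding`, Prop `HeckeUnfolding`) of the fact skeleton I1
`poincare-hecke` for `kowalskiMichel2000_peterssonFormula` (crux item stmt-Parity-20404) —
Iwaniec–Kowalski, Lemma 14.3 at `k = 2` with Hecke's factor: for `s > 0`, `m ≥ 1` and
`f ∈ S_2(Γ₀(N))`,

  `peterssonPairing N 2 (yˢ P_m(·, s)) f = Γ(s+1) (4πm)^{−(s+1)} a_f(m)`.

Proof (the printed unfolding): by part I (`…UnfoldingPointwise.lean`) the Petersson integrand is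
`½ Σ'_{δ ∈ Γ₀(N)} v(δ g_q⁻¹ τ)` summed over the cosets, `v = 1_{0 ≤ Re < 1} · h`,
`h(w) = conj(e(mw)) (Im w)^{s+2} f(w)`; the tree's unfolding `Unfolding.integral_fd_sum_tsum_smul_eq`
gives `½ · 2 ∫_ℍ v dμ = ∫_{0 ≤ Re < 1} h dμ`; in coordinates (`dμ = dx dy/y²`, the strip version of the
tree's transport `setIntegral_upperHalfPlane_im_mem_eq`) this is
`∫₀^∞ y^s e^{−2πmy} (∫₀¹ f(x+iy) e(−mx) dx) dy = a_f(m) ∫₀^∞ y^s e^{−4πmy} dy = a_f(m) Γ(s+1)/(4πm)^{s+1}`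
(tree `fourierCoeffOn_horizontal_int`; Mathlib `Real.integral_rpow_mul_exp_neg_mul_Ioi`). Integrability
from Mathlib's `CuspFormClass.exists_bound` (`|f| ≤ C/y` at weight 2): `|h| ≤ C e^{−2πmy} y^{s+1}`.

* `heckeUnfolding` — the statement in the exact shape of the skeleton's `HeckeUnfolding`.

Cell `landau-siegel` / `ls-inputs` (D-0154 (2)), seat `ls-inputs-I1-w2`. «The programme SEARCHES and
TYPES; no claim about Landau–Siegel zeros, Theorems 1–2 of arXiv:2211.02515 or a repaired Margin232
until a kernel theorem says so.»

## References

* [IwaniecKowalski2004] H. Iwaniec, E. Kowalski, *Analytic Number Theory*, Lemma 14.3 (proof),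
  (3.29) of Iwaniec's *Topics*; §3.2 (Hecke's trick).
* [Iwaniec2002] H. Iwaniec, *Spectral Methods of Automorphic Forms*, §3.2 (3.13).
* [Freitag1990] E. Freitag, *Hilbert Modular Forms*, Ch. II §1 Remark 1.1 (`dω = dx dy/y²`).
-/

noncomputable section

open scoped MatrixGroups Real ModularForm ComplexConjugate NNReal ENNReal
open CongruenceSubgroup Complex MeasureTheory Set Filter
open UpperHalfPlane hiding I
open Literature.NumberTheory.EllipticCurves.ModularForms

namespace Literature.NumberTheory.ModularForms.PoincareWeightTwo

/-! ### The strip `{0 ≤ Re < 1} ⊆ ℍ` in coordinates (Bochner form) -/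

section Strip

/-- The density of the invariant measure read on `ℂ` is measurable. [folklore] -/
private theorem measurable_invImSq' : Measurable fun z : ℂ ↦ ((1 / ‖z.im‖₊) ^ 2 : ℝ≥0) :=
  (measurable_const.div Complex.measurable_im.nnnorm).pow_const 2

/-- **Transport `ℍ → ℂ → ℝ × ℝ` of a set integral over the strip `{0 ≤ Re w < 1}`**:
`∫_{0 ≤ Re < 1} G(w) dμ = ∫_{(y,x) ∈ (0,∞) × [0,1)} y⁻² G(x+iy) dy dx`, together with the transport of
absolute convergence (the strip version of the tree's `setIntegral_upperHalfPlane_im_mem_eq`;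
`dμ = dx dy / y²`). [cite: Freitag1990, Ch. II §1 Remark 1.1] -/
theorem setIntegral_strip_eq_prod (G : ℂ → ℂ) :
    (IntegrableOn (fun w : ℍ ↦ G w) {w : ℍ | 0 ≤ w.re ∧ w.re < 1} volume ↔
      IntegrableOn (fun q : ℝ × ℝ ↦ ((((1 / ‖(⟨q.2, q.1⟩ : ℂ).im‖₊) ^ 2 : ℝ≥0) : ℝ)) • G ⟨q.2, q.1⟩)
        (Ioi (0 : ℝ) ×ˢ Ico (0 : ℝ) 1) (volume.prod volume)) ∧
    ∫ w in {w : ℍ | 0 ≤ w.re ∧ w.re < 1}, G w =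
      ∫ q in Ioi (0 : ℝ) ×ˢ Ico (0 : ℝ) 1,
        ((((1 / ‖(⟨q.2, q.1⟩ : ℂ).im‖₊) ^ 2 : ℝ≥0) : ℝ)) • G ⟨q.2, q.1⟩ ∂(volume.prod volume) := by
  -- adapted from `Literature/Analysis/Complex/SelbergTraceHyperbolicVanishing.lean`
  set ρ : ℂ → ℝ≥0 := fun z ↦ (1 / ‖z.im‖₊) ^ 2 with hρ
  have hρm : Measurable ρ := measurable_invImSq'
  have hmap : (volume : Measure ℍ).map UpperHalfPlane.coe =
      (volume.restrict UpperHalfPlane.upperHalfPlaneSet).withDensity fun z ↦ ρ z := by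
    ext A hA
    rw [Measure.map_apply UpperHalfPlane.measurable_coe hA, UpperHalfPlane.volume_eq_lintegral,
      withDensity_apply _ hA, Measure.restrict_restrict hA, Set.image_preimage_eq_inter_range,
      UpperHalfPlane.range_coe]
  have hpres : MeasurePreserving UpperHalfPlane.coe (volume : Measure ℍ)
      ((volume.restrict UpperHalfPlane.upperHalfPlaneSet).withDensity fun z ↦ ρ z) :=
    ⟨UpperHalfPlane.measurable_coe, hmap⟩
  have hT' : MeasurableSet {z : ℂ | 0 ≤ z.re ∧ z.re < 1} :=
    (measurableSet_le measurable_const Complex.measurable_re).inter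
      (measurableSet_lt Complex.measurable_re measurable_const)
  have hT : {w : ℍ | 0 ≤ w.re ∧ w.re < 1} = UpperHalfPlane.coe ⁻¹' {z : ℂ | 0 ≤ z.re ∧ z.re < 1} := rfl
  have hU : MeasurableSet UpperHalfPlane.upperHalfPlaneSet :=
    UpperHalfPlane.isOpen_upperHalfPlaneSet.measurableSet
  have hTU : {z : ℂ | 0 ≤ z.re ∧ z.re < 1} ∩ UpperHalfPlane.upperHalfPlaneSet =
      {z : ℂ | (0 ≤ z.re ∧ z.re < 1) ∧ 0 < z.im} := by
    ext z; simp [UpperHalfPlane.upperHalfPlaneSet]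
  have hT'' : MeasurableSet {z : ℂ | (0 ≤ z.re ∧ z.re < 1) ∧ 0 < z.im} :=
    hT'.inter (measurableSet_lt measurable_const Complex.measurable_im)
  set e : ℝ × ℝ → ℂ := fun q ↦ Complex.measurableEquivRealProd.symm q.swap with he
  have he_emb : MeasurableEmbedding e :=
    Complex.measurableEquivRealProd.symm.measurableEmbedding.comp
      MeasurableEquiv.prodComm.measurableEmbedding
  have he_pres : MeasurePreserving e (volume.prod volume) volume :=
    Complex.volume_preserving_equiv_real_prod.symm.comp
      (Measure.measurePreserving_swap (μ := (volume : Measure ℝ)) (ν := (volume : Measure ℝ)))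
  have he_apply : ∀ q : ℝ × ℝ, e q = ⟨q.2, q.1⟩ := fun q ↦ rfl
  have he_pre : e ⁻¹' {z : ℂ | (0 ≤ z.re ∧ z.re < 1) ∧ 0 < z.im} = Ioi (0 : ℝ) ×ˢ Ico (0 : ℝ) 1 := by
    ext q
    simp only [he_apply, mem_preimage, mem_setOf_eq, mem_prod, mem_Ioi, mem_Ico]
    tauto
  constructor
  · rw [hT, show (fun w : ℍ ↦ G w) = G ∘ UpperHalfPlane.coe from rfl,
      hpres.integrableOn_comp_preimage UpperHalfPlane.measurableEmbedding_coe, IntegrableOn,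
      restrict_withDensity hT', Measure.restrict_restrict hT', hTU,
      integrable_withDensity_iff_integrable_smul hρm, ← he_pre, ← IntegrableOn,
      ← he_pres.integrableOn_comp_preimage he_emb]
    rfl
  · rw [hT, hpres.setIntegral_preimage_emb UpperHalfPlane.measurableEmbedding_coe,
      restrict_withDensity hT', Measure.restrict_restrict hT', hTU, ← restrict_withDensity hT'',
      setIntegral_withDensity_eq_setIntegral_smul hρm _ hT'', ← he_pre,
      ← he_pres.setIntegral_preimage_emb he_emb]
    rfl

/-- `(1/|Im(x + iy)|)² = y⁻²` (`y > 0`). [cite: Freitag1990, Ch. II §1 Remark 1.1] -/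
private theorem coe_invImSq_mk' (x : ℝ) {y : ℝ} (hy : 0 < y) :
    (((1 / ‖(⟨x, y⟩ : ℂ).im‖₊) ^ 2 : ℝ≥0) : ℝ) = (y ^ 2)⁻¹ := by
  push_cast
  rw [Real.norm_of_nonneg hy.le, one_div, inv_pow]

end Strip

/-! ### The seed `h(w) = conj(e(mw)) (Im w)^{s+2} f(w)` read on `ℂ` -/

section Seed

variable {N : ℕ} [NeZero N]

/-- The seed of the unfolding read on `ℂ` (through Mathlib's retraction `ofComplex`):
`h(z) = conj(e(mz)) · (Im z)^{s+2} · f(z)`. Private plumbing. [folklore] -/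
private def seedC (m : ℕ) (s : ℝ) (f : CuspForm (Gamma0 N) 2) (z : ℂ) : ℂ :=
  conj (cexp (2 * π * I * m * z)) * ((z.im ^ (s + 2) : ℝ) : ℂ) * f (UpperHalfPlane.ofComplex z)

omit [NeZero N] in
/-- On `ℍ` the seed read on `ℂ` is the seed. [folklore] -/
private theorem seedC_coe (m : ℕ) (s : ℝ) (f : CuspForm (Gamma0 N) 2) (w : ℍ) :
    seedC m s f (w : ℂ) = conj (cexp (2 * π * I * m * (w : ℂ))) * ((w.im ^ (s + 2) : ℝ) : ℂ) * f w := by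
  rw [seedC, UpperHalfPlane.ofComplex_apply, UpperHalfPlane.coe_im]

omit [NeZero N] in
/-- The seed is measurable on `ℂ`. [folklore] -/
private theorem measurable_seedC (m : ℕ) (s : ℝ) (f : CuspForm (Gamma0 N) 2) :
    Measurable (seedC m s f) := by
  unfold seedC
  refine Measurable.mul (Measurable.mul ?_ ?_) ?_
  · exact (Complex.continuous_conj.measurable.comp
      (Complex.measurable_exp.comp (measurable_const.mul measurable_id)))
  · exact Complex.measurable_ofReal.comp ((Complex.measurable_im).pow_const _)
  · exact (ModularFormClass.continuous f).measurable.comp measurable_ofComplex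

/-- `|conj(e(mz))| = e^{−2πm Im z}`. [folklore] -/
private theorem norm_conj_cexp (m : ℕ) (z : ℂ) :
    ‖conj (cexp (2 * π * I * m * z))‖ = Real.exp (-(2 * π * m * z.im)) := by
  rw [Complex.norm_conj, Complex.norm_exp]
  congr 1
  simp only [mul_re, mul_im, re_ofNat, im_ofNat, ofReal_re, ofReal_im, Complex.I_re, Complex.I_im,
    natCast_re, natCast_im]
  ring

/-- `conj(e(m(x+iy))) = e^{−2πmy} · e(−mx)`. [folklore] -/
private theorem conj_cexp_mk (m : ℕ) (x y : ℝ) :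
    conj (cexp (2 * π * I * m * (⟨x, y⟩ : ℂ))) =
      ((Real.exp (-(2 * π * m * y)) : ℝ) : ℂ) * cexp (-(2 * π * I * m * x)) := by
  rw [← Complex.exp_conj, Complex.ofReal_exp, ← Complex.exp_add]
  congr 1
  apply Complex.ext <;>
    simp [mul_re, mul_im, Complex.conj_re, Complex.conj_im, Complex.I_re, Complex.I_im]

omit [NeZero N] in
/-- **The size of the seed against the invariant density**: for `y > 0`,
`y⁻² |h(x+iy)| ≤ C y^{s−1} e^{−2πmy}` where `|f| ≤ C/y` (Mathlib `CuspFormClass.exists_bound` at weight 2).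
[cite: IwaniecKowalski2004, Lemma 14.3 (proof: absolute convergence)] -/
private theorem norm_invImSq_smul_seed_le (m : ℕ) (s : ℝ) (f : CuspForm (Gamma0 N) 2) {C : ℝ}
    (hC : ∀ τ : ℍ, ‖f τ‖ ≤ C / τ.im ^ ((2 : ℤ) / 2 : ℝ)) (x : ℝ) {y : ℝ} (hy : 0 < y) :
    ‖((((1 / ‖(⟨x, y⟩ : ℂ).im‖₊) ^ 2 : ℝ≥0) : ℝ)) • seedC m s f ⟨x, y⟩‖ ≤
      C * (y ^ (s - 1) * Real.exp (-(2 * π * m) * y)) := by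
  have hz : 0 < (⟨x, y⟩ : ℂ).im := hy
  have hτ : (UpperHalfPlane.ofComplex ⟨x, y⟩).im = y := by
    rw [UpperHalfPlane.ofComplex_apply_of_im_pos hz]; rfl
  have hf : ‖f (UpperHalfPlane.ofComplex ⟨x, y⟩)‖ ≤ C / y := by
    have := hC (UpperHalfPlane.ofComplex ⟨x, y⟩)
    rwa [hτ, show (((2 : ℤ) : ℝ) / 2) = 1 by norm_num, Real.rpow_one] at this
  have him : (⟨x, y⟩ : ℂ).im = y := rfl
  rw [seedC, norm_smul, coe_invImSq_mk' x hy, norm_mul, norm_mul, norm_conj_cexp, Complex.norm_real, him,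
    Real.norm_of_nonneg (Real.rpow_nonneg hy.le _), Real.norm_of_nonneg (by positivity)]
  calc (y ^ 2)⁻¹ * (Real.exp (-(2 * π * m * y)) * y ^ (s + 2) * ‖f (UpperHalfPlane.ofComplex ⟨x, y⟩)‖)
      ≤ (y ^ 2)⁻¹ * (Real.exp (-(2 * π * m * y)) * y ^ (s + 2) * (C / y)) := by
        gcongr
    _ = C * (y ^ (s - 1) * Real.exp (-(2 * π * m) * y)) := by
        have h3 : y ^ (s + 2) = y ^ (s - 1) * y ^ (3 : ℕ) := by
          rw [← Real.rpow_natCast, ← Real.rpow_add hy]; congr 1; push_cast; ring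
        rw [h3, neg_mul]
        field_simp

/-- **Absolute convergence of the unfolded integral in coordinates**: for `s > 0`, `m ≥ 1`,
`(y, x) ↦ y⁻² h(x + iy)` is integrable on `(0,∞) × [0,1)` (majorant `C y^{s−1} e^{−2πmy}`, a Gamma
integral). [cite: IwaniecKowalski2004, Lemma 14.3 (proof: absolute convergence)] -/
private theorem integrableOn_invImSq_smul_seed (m : ℕ) (hm : 1 ≤ m) {s : ℝ} (hs : 0 < s)
    (f : CuspForm (Gamma0 N) 2) :
    IntegrableOn (fun q : ℝ × ℝ ↦ ((((1 / ‖(⟨q.2, q.1⟩ : ℂ).im‖₊) ^ 2 : ℝ≥0) : ℝ)) • seedC m s f ⟨q.2, q.1⟩)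
      (Ioi (0 : ℝ) ×ˢ Ico (0 : ℝ) 1) (volume.prod volume) := by
  obtain ⟨C, hC⟩ := CuspFormClass.exists_bound f
  have hmpos : (0 : ℝ) < 2 * π * m := by
    have : (1 : ℝ) ≤ m := by exact_mod_cast hm
    positivity
  -- the majorant in `y`
  have hI : IntegrableOn (fun y : ℝ ↦ y ^ (s - 1) * Real.exp (-(2 * π * m) * y)) (Ioi 0) := by
    have h := integrableOn_rpow_mul_exp_neg_mul_rpow (s := s - 1) (p := 1) (b := 2 * π * m)
      (by linarith) le_rfl hmpos
    refine h.congr_fun (fun y _ ↦ ?_) measurableSet_Ioi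
    simp only [Real.rpow_one]
  have hM : Integrable (fun q : ℝ × ℝ ↦ (C * (q.1 ^ (s - 1) * Real.exp (-(2 * π * m) * q.1))) * (1 : ℝ))
      ((volume.restrict (Ioi (0 : ℝ))).prod (volume.restrict (Ico (0 : ℝ) 1))) :=
    Integrable.mul_prod (hI.const_mul C) (integrable_const 1)
  rw [IntegrableOn, ← Measure.prod_restrict]
  refine hM.mono' ?_ ?_
  · refine (Measurable.aestronglyMeasurable ?_)
    have he : Measurable fun q : ℝ × ℝ ↦ (⟨q.2, q.1⟩ : ℂ) :=
      Complex.measurableEquivRealProd.symm.measurable.comp measurable_swap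
    exact (measurable_coe_nnreal_real.comp (measurable_invImSq'.comp he)).smul
      ((measurable_seedC m s f).comp he)
  · rw [Measure.prod_restrict]
    filter_upwards [ae_restrict_mem (measurableSet_Ioi.prod measurableSet_Ico)] with q hq
    rw [mul_one]
    exact norm_invImSq_smul_seed_le m s f hC q.2 (mem_prod.mp hq).1

/-- **The seed is integrable on the strip** `{0 ≤ Re < 1} ⊆ ℍ` (`s > 0`, `m ≥ 1`).
[cite: IwaniecKowalski2004, Lemma 14.3 (proof: absolute convergence)] -/
theorem integrableOn_seed_strip (m : ℕ) (hm : 1 ≤ m) {s : ℝ} (hs : 0 < s) (f : CuspForm (Gamma0 N) 2) :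
    IntegrableOn (fun w : ℍ ↦ conj (cexp (2 * π * I * m * (w : ℂ))) * ((w.im ^ (s + 2) : ℝ) : ℂ) * f w)
      {w : ℍ | 0 ≤ w.re ∧ w.re < 1} volume := by
  have h := (setIntegral_strip_eq_prod (seedC m s f)).1.mpr (integrableOn_invImSq_smul_seed m hm hs f)
  refine h.congr_fun (fun w _ ↦ seedC_coe m s f w) ?_
  exact (measurableSet_le measurable_const UpperHalfPlane.continuous_re.measurable).inter
    (measurableSet_lt UpperHalfPlane.continuous_re.measurable measurable_const)

/-! ### The strip integral `∫_{0 ≤ Re < 1} h dμ = a_f(m) Γ(s+1)/(4πm)^{s+1}` -/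

omit [NeZero N] in
/-- **The horizontal integral picks the `m`-th coefficient**: for `y > 0`,
`∫₀¹ e(−mx) f(x+iy) dx = a_f(m) e^{−2πmy}` (tree `fourierCoeffOn_horizontal_int`).
[cite: IwaniecKowalski2004, Lemma 14.3 (proof)] -/
theorem setIntegral_Ico_cexp_mul_eq (f : CuspForm (Gamma0 N) 2) (m : ℕ) {y : ℝ} (hy : 0 < y) :
    ∫ x in Ico (0 : ℝ) 1, cexp (-(2 * π * I * m * x)) * f (UpperHalfPlane.ofComplex ⟨x, y⟩) =
      cuspCoeff f m * ((Real.exp (-(2 * π * m * y)) : ℝ) : ℂ) := by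
  have hΓ : (1 : ℝ) ∈ (Gamma0 N : Subgroup (GL (Fin 2) ℝ)).strictPeriods := by
    rw [strictPeriods_Gamma0]; exact AddSubgroup.mem_zmultiples 1
  have hpt : ∀ x : ℝ, UpperHalfPlane.ofComplex ⟨x, y⟩ = ⟨x + y * Complex.I, by simp [hy]⟩ := by
    intro x
    rw [UpperHalfPlane.ofComplex_apply_of_im_pos (show 0 < (⟨x, y⟩ : ℂ).im from hy)]
    exact UpperHalfPlane.ext (Complex.mk_eq_add_mul_I x y)
  simp_rw [hpt]
  have hF := fourierCoeffOn_horizontal_int hΓ f hy (m : ℤ)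
  rw [tsum_eq_single m (fun n hn ↦ if_neg (by exact_mod_cast hn)), if_pos rfl,
    fourierCoeffOn_eq_integral, sub_zero, one_div, inv_one, one_smul,
    intervalIntegral.integral_of_le zero_le_one] at hF
  rw [setIntegral_congr_set Ico_ae_eq_Ioc, ← hF]
  refine setIntegral_congr_fun measurableSet_Ioc fun x _ ↦ ?_
  rw [fourier_coe_apply, smul_eq_mul]
  congr 1
  congr 1
  push_cast
  ring

/-- **The strip integral of the seed**: for `s > 0`, `m ≥ 1`,
`∫_{0 ≤ Re < 1} conj(e(mw)) (Im w)^{s+2} f(w) dμ(w) = Γ(s+1)(4πm)^{−(s+1)} a_f(m)`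
(`= ∫₀^∞ y^s e^{−2πmy}·a_f(m)e^{−2πmy} dy`). [cite: IwaniecKowalski2004, Lemma 14.3 (proof, (3.29) of Iwaniec's Topics)] -/
theorem setIntegral_seed_strip (m : ℕ) (hm : 1 ≤ m) {s : ℝ} (hs : 0 < s) (f : CuspForm (Gamma0 N) 2) :
    ∫ w in {w : ℍ | 0 ≤ w.re ∧ w.re < 1},
        conj (cexp (2 * π * I * m * (w : ℂ))) * ((w.im ^ (s + 2) : ℝ) : ℂ) * f w =
      ((Real.Gamma (s + 1) / (4 * π * m) ^ (s + 1) : ℝ) : ℂ) * cuspCoeff f m := by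
  have hmpos : (0 : ℝ) < 4 * π * m := by
    have : (1 : ℝ) ≤ m := by exact_mod_cast hm
    positivity
  -- to coordinates
  have e1 : ∫ w in {w : ℍ | 0 ≤ w.re ∧ w.re < 1},
      conj (cexp (2 * π * I * m * (w : ℂ))) * ((w.im ^ (s + 2) : ℝ) : ℂ) * f w =
      ∫ w in {w : ℍ | 0 ≤ w.re ∧ w.re < 1}, seedC m s f w :=
    setIntegral_congr_fun ((measurableSet_le measurable_const UpperHalfPlane.continuous_re.measurable).inter
      (measurableSet_lt UpperHalfPlane.continuous_re.measurable measurable_const)) fun w _ ↦ (seedC_coe m s f w).symm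
  rw [e1, (setIntegral_strip_eq_prod (seedC m s f)).2,
    setIntegral_prod _ (integrableOn_invImSq_smul_seed m hm hs f)]
  -- the inner integral
  have hinner : ∀ y ∈ Ioi (0 : ℝ), ∫ x in Ico (0 : ℝ) 1,
      ((((1 / ‖(⟨(y, x).2, (y, x).1⟩ : ℂ).im‖₊) ^ 2 : ℝ≥0) : ℝ)) • seedC m s f ⟨(y, x).2, (y, x).1⟩ =
      cuspCoeff f m * (((y ^ s * Real.exp (-(4 * π * m * y))) : ℝ) : ℂ) := by
    intro y hy
    rw [mem_Ioi] at hy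
    have e2 : ∀ x : ℝ, ((((1 / ‖(⟨(y, x).2, (y, x).1⟩ : ℂ).im‖₊) ^ 2 : ℝ≥0) : ℝ)) •
        seedC m s f ⟨(y, x).2, (y, x).1⟩ =
        (((y ^ 2)⁻¹ * (Real.exp (-(2 * π * m * y)) * y ^ (s + 2)) : ℝ) : ℂ) *
          (cexp (-(2 * π * I * m * x)) * f (UpperHalfPlane.ofComplex ⟨x, y⟩)) := by
      intro x
      dsimp only
      rw [coe_invImSq_mk' x hy, seedC, conj_cexp_mk, Complex.real_smul]
      have him : (⟨x, y⟩ : ℂ).im = y := rfl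
      rw [him]
      push_cast
      ring
    simp_rw [e2]
    rw [integral_const_mul, setIntegral_Ico_cexp_mul_eq f m hy]
    have hp : (y ^ 2)⁻¹ * (Real.exp (-(2 * π * m * y)) * y ^ (s + 2)) * Real.exp (-(2 * π * m * y)) =
        y ^ s * Real.exp (-(4 * π * m * y)) := by
      rw [Real.rpow_add hy, Real.rpow_two, show -(4 * π * m * y) = -(2 * π * m * y) + -(2 * π * m * y) by ring,
        Real.exp_add]
      field_simp
    rw [← hp]
    push_cast
    ring
  rw [setIntegral_congr_fun measurableSet_Ioi hinner, integral_const_mul, integral_complex_ofReal]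
  have hG : ∫ y in Ioi (0 : ℝ), y ^ s * Real.exp (-(4 * π * m * y)) =
      (1 / (4 * π * m)) ^ (s + 1) * Real.Gamma (s + 1) := by
    rw [← Real.integral_rpow_mul_exp_neg_mul_Ioi (by linarith : 0 < s + 1) hmpos]
    refine setIntegral_congr_fun measurableSet_Ioi fun y _ ↦ ?_
    rw [add_sub_cancel_right]
  rw [hG, Real.div_rpow zero_le_one hmpos.le, Real.one_rpow]
  push_cast
  ring

end Seed

/-! ### Assembly: the unfolding -/

section Unfolding

variable {N : ℕ} [NeZero N]

/-- **Stub U of the I1 fact skeleton `poincare-hecke` (`stub_heckeUnfolding`), VERBATIM body of its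
`HeckeUnfolding`: unfolding at `s > 0` against a cusp form** — for `N ≥ 1`, `m ≥ 1`, `s > 0` and
`f ∈ S_2(Γ₀(N))`, `⟨yˢ P_m(·, s), f⟩ = Γ(s+1) (4πm)^{−(s+1)} a_f(m)` with the tree's pairing
`peterssonPairing` (conjugate-linear in the first slot, no volume normalisation; Iwaniec–Kowalski
Lemma 14.3 at `k = 2` with Hecke's factor: the Petersson integrand is
`½ Σ'_{δ ∈ Γ₀(N)} (1_{0≤Re<1}·h)(δ g_q⁻¹ τ)` over the cosets, the tree's unfolding
`Unfolding.integral_fd_sum_tsum_smul_eq` turns `∫_𝒟 Σ_q` into `2∫_ℍ`, and the strip integral of the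
seed is `setIntegral_seed_strip`). [cite: IwaniecKowalski2004, Lemma 14.3 (k = 2 with Hecke's factor, §3.2)] -/
theorem heckeUnfolding :
    ∀ (N : ℕ) [NeZero N] (m : ℕ), 1 ≤ m → ∀ (s : ℝ), 0 < s → ∀ f : CuspForm (Gamma0 N) 2,
      peterssonPairing N 2 (fun z : ℍ ↦ ((z.im ^ s : ℝ) : ℂ) * poincareHecke N m s z) ⇑f =
        ((Real.Gamma (s + 1) / (4 * π * m) ^ (s + 1) : ℝ) : ℂ) * cuspCoeff f m := by
  intro N _ m hm s hs f
  letI : Fintype (↥𝒮ℒ ⧸ (Gamma0 N : Subgroup (GL (Fin 2) ℝ)).subgroupOf 𝒮ℒ) := Fintype.ofFinite _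
  obtain ⟨g, hg⟩ := exists_mapGL_eq_out (N := N)
  -- the seed, the strip and its cut-off
  set h : ℍ → ℂ := fun w ↦
    conj (cexp (2 * π * I * m * (w : ℂ))) * ((w.im ^ (s + 2) : ℝ) : ℂ) * f w with hhdef
  set P : Set ℍ := {u : ℍ | 0 ≤ u.re ∧ u.re < 1} with hPdef
  have hP : MeasurableSet P :=
    (measurableSet_le measurable_const UpperHalfPlane.continuous_re.measurable).inter
      (measurableSet_lt UpperHalfPlane.continuous_re.measurable measurable_const)
  set v : ℍ → ℂ := P.indicator h with hvdef
  have hT : ∀ (n : ℤ) (w : ℍ), h (ModularGroup.T ^ n • w) = h w := fun n w ↦ seed_T_zpow_smul m s f n w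
  -- Step 1: the Petersson integrand through the cosets is `½ Σ_q Σ'_δ v(δ g_q⁻¹ τ)`
  have h1 : ∀ τ : ℍ, ∑ q : ↥𝒮ℒ ⧸ (Gamma0 N : Subgroup (GL (Fin 2) ℝ)).subgroupOf 𝒮ℒ,
        petersson 2 (fun z : ℍ ↦ ((z.im ^ s : ℝ) : ℂ) * poincareHecke N m s z) ⇑f
          (((q.out : ↥𝒮ℒ) : GL (Fin 2) ℝ)⁻¹ • τ) =
      (1 / 2 : ℂ) * ∑ q : ↥𝒮ℒ ⧸ (Gamma0 N : Subgroup (GL (Fin 2) ℝ)).subgroupOf 𝒮ℒ,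
        ∑' δ : Gamma0 N, v ((δ : SL(2, ℤ)) • (g q)⁻¹ • τ) := by
    intro τ
    rw [Finset.mul_sum]
    refine Finset.sum_congr rfl fun q _ ↦ ?_
    have hsm : ((q.out : ↥𝒮ℒ) : GL (Fin 2) ℝ)⁻¹ • τ = (g q)⁻¹ • τ := by
      rw [← hg q, ← map_inv]; rfl
    rw [hsm, petersson_rpow_mul_poincareHecke_eq_tsum, ← tsum_gamma0_indicator_eq_tsum_rows h hT]
  -- Step 2: integrability of the cut-off seed on `ℍ`
  have hh_meas : Measurable h := by
    have hfun : h = seedC m s f ∘ UpperHalfPlane.coe := funext fun w ↦ (seedC_coe m s f w).symm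
    rw [hfun]
    exact (measurable_seedC m s f).comp UpperHalfPlane.measurable_coe
  have hv_meas : Measurable v := hh_meas.indicator hP
  have hv_int : Integrable v := (integrableOn_seed_strip m hm hs f).integrable_indicator hP
  -- Step 3: unfold (`∫_𝒟 Σ_q Σ'_δ v(δ g_q⁻¹ τ) = 2 ∫_ℍ v`) and evaluate the strip integral
  unfold peterssonPairing
  rw [setIntegral_congr_fun ModularGroup.isClosed_fd.measurableSet (fun τ _ ↦ h1 τ), integral_const_mul,
    Unfolding.integral_fd_sum_tsum_smul_eq g hg v hv_int hv_meas, hvdef, integral_indicator hP, hhdef,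
    hPdef, setIntegral_seed_strip m hm hs f]
  ring

end Unfolding

end Literature.NumberTheory.ModularForms.PoincareWeightTwo

end
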